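import Summits.RiemannHypothesis.RiemannHypothesis.Theorems.SuzukiWindowsDoorArchLeadingTermReal
import Summits.RiemannHypothesis.RiemannHypothesis.Theorems.SuzukiWindowsDoorSmallWindowLaw

/-!
# SuzukiWindowsDoorSmallWindowLawReal — the small-window law `‖𝖪_θ[t]‖ = c_θ‖A_θ‖t^θ(1 + O(t))` for every REAL `θ > 1` (column DBR; RH-FREE)

LINE 1 — LABEL: RH-FREE structure theorems (asymptotics with explicit constants) about Suzuki's single operator `𝖪_θ[t]`
([Su20] (1.4)/(1.10)) for the FULL real family `θ > 1`; bears_on: LADDER-RH B-D(b) → B-P(P2) (PROOF-OF-DATA; extends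
`SuzukiWindowsDoorSmallWindowLaw` (integer `θ`) to DATA-1b's `θ ∈ {5/4, 3/2}`, EXP-R2a's pair `3/2 → 2` and the `θ → 1⁺`
regime; D-0117: a structural LAW, not a range extension).  WHAT THIS IS NOT: no window is moved or certified, nothing is a
statement about `ζ`'s zeros, the residual `AllWindowsWitness` stays RH-EQUIVALENT and unclaimed; nothing here bears on RH.

For real `θ > 1`, `c_θ = (2π)^θ/Γ(θ)`, the ONSET OPERATOR `A_θ` = any bounded `B` on `L²(−1,1)` with the kernel
`(u+v)₊^{θ−1}` (real power; `SuzukiWindowsDoorKernelMonotone`), and any bounded realisation `A` of `𝖪_θ[t]`: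

* §1 `abs_dilKernel_sub_leading_le_real`, **`abs_opNorm_winOp_sub_leading_le_real`**:
  `|‖A‖ − c_θ‖B‖t^θ| ≤ 2D_θ t^{θ+1}` for `0 < t ≤ 1/12`, `D_θ = c_θ2^{θ−1} + 6θ(4πe/θ)^θ`;
  **`tendsto_opNorm_winOp_div_rpow`**: `‖A_t‖/t^θ → c_θ‖B‖` (`t → 0⁺`);
* §2 onset bounds for real `θ`: `integral_onsetKernel_row_real`, **`sq_opNorm_onsetOp_ge_real`** (`‖A_θ‖² ≥ 2^{2θ}/(θ²(2θ+1))`),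
  **`sq_opNorm_onsetOp_le_real`** (`‖A_θ‖² ≤ 2^{2θ}/((2θ−1)2θ)`), `opNorm_onsetOp_pos_real`.

Method: identical to the integer file (dilation `SuzukiWindowsDoorWindowDilation.opNorm_winOp_eq_dilate`, kernel split, Hilbert–Schmidt
bound of the error operator, reverse triangle inequality), with the real small-`x` law
`SuzukiWindowsDoorArchLeadingTermReal.abs_limKernel_sub_leading_le_real` in place of the integer one.

References: [Su20] M. Suzuki, ASPM 84 (2020) = arXiv:1907.07302; DATA.md §ET1f-lite, §ET1i, DATA-1b.
-/

noncomputable section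

-- D-0017: `Summit.<S>.<S>.…` is the designed namespace of a single-problem summit.
set_option linter.dupNamespace false

open MeasureTheory Set Filter Topology

namespace Summit.RiemannHypothesis.RiemannHypothesis.Theorems.SuzukiWindowsDoorSmallWindowLawReal

open Literature.NumberTheory.LFunctions Literature.Analysis.OperatorTheory
open Summit.RiemannHypothesis.RiemannHypothesis.Theorems.SuzukiWindowsDoorTempleGalerkin
open Summit.RiemannHypothesis.RiemannHypothesis.Theorems.SuzukiWindowsDoorExplicitOpNorm
open Summit.RiemannHypothesis.RiemannHypothesis.Theorems.SuzukiWindowsDoorArchLeadingTermReal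
open Summit.RiemannHypothesis.RiemannHypothesis.Theorems.SuzukiWindowsDoorWindowDilation
open Summit.RiemannHypothesis.RiemannHypothesis.Theorems.SuzukiKernelSemigroup (limKernel_eq_zero_of_nonpos)

variable {θ : ℝ}

/-! ## §1 The small-window law for real `θ > 1` -/

/-- RH-FREE.  **The dilated kernel minus its leading term, real `θ > 1`**: for `0 < t ≤ 1/12` and `w < 2`,
`|t·K_θ(tw) − c_θ t^θ w₊^{θ−1}| ≤ D_θ t^{θ+1}`, `c_θ = (2π)^θ/Γ(θ)`, `D_θ = c_θ 2^{θ−1} + 6θ(4πe/θ)^θ`. -/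
theorem abs_dilKernel_sub_leading_le_real (hθ : 1 < θ) {t : ℝ} (ht0 : 0 < t) (ht : t ≤ 1 / 12)
    {w : ℝ} (hw : w < 2) :
    |t * limKernel θ (t * w) - (2 * Real.pi) ^ θ / Real.Gamma θ * t ^ θ * (max w 0) ^ (θ - 1)| ≤
      ((2 * Real.pi) ^ θ / Real.Gamma θ * 2 ^ (θ - 1) +
          6 * θ * (4 * Real.pi * Real.exp 1 / θ) ^ θ) * t ^ (θ + 1) := by
  have hθ0 : 0 < θ := by linarith
  have hθ1 : 0 ≤ θ - 1 := by linarith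
  have h2π : 0 < 2 * Real.pi := by positivity
  have hΓ : 0 < Real.Gamma θ := Real.Gamma_pos_of_pos hθ0
  set c : ℝ := (2 * Real.pi) ^ θ / Real.Gamma θ with hcdef
  have hc0 : 0 ≤ c := by positivity
  have htθ : 0 < t ^ θ := Real.rpow_pos_of_pos ht0 θ
  have htθ1 : 0 < t ^ (θ + 1) := Real.rpow_pos_of_pos ht0 _
  have hD2 : 0 ≤ 6 * θ * (4 * Real.pi * Real.exp 1 / θ) ^ θ := by positivity
  rcases le_or_gt w 0 with hw0 | hw0
  · have h1 : limKernel θ (t * w) = 0 := limKernel_eq_zero_of_nonpos hθ (mul_nonpos_of_nonneg_of_nonpos ht0.le hw0)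
    have h2 : (max w 0) ^ (θ - 1) = 0 := by rw [max_eq_right hw0, Real.zero_rpow (by linarith)]
    rw [h1, h2, mul_zero, mul_zero, sub_zero, abs_zero]
    positivity
  · set x : ℝ := t * w with hxdef
    have hx0 : 0 < x := mul_pos ht0 hw0
    have hx2t : x ≤ 2 * t := by rw [hxdef]; nlinarith
    have hx : x ≤ 1 / 6 := by linarith
    have hK := abs_limKernel_sub_leading_le_real hθ hx0 hx
    have hmax : max w 0 = w := max_eq_left hw0.le
    -- `t·lead(x) = c t^θ w^{θ−1} e^{−x/2}`
    have hxpow : x ^ (θ - 1) = t ^ (θ - 1) * w ^ (θ - 1) := by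
      rw [hxdef, Real.mul_rpow ht0.le hw0.le]
    have htpow : t * t ^ (θ - 1) = t ^ θ := by
      rw [show θ = (θ - 1) + 1 by ring, Real.rpow_add_one ht0.ne' (θ - 1), show θ - 1 + 1 - 1 = θ - 1 by ring]
      ring
    have hlead : t * ((2 * Real.pi) ^ θ * (x ^ (θ - 1) * Real.exp (-(x / 2)) / Real.Gamma θ)) =
        c * t ^ θ * w ^ (θ - 1) * Real.exp (-(x / 2)) := by
      rw [hxpow, hcdef, ← htpow]; ring
    have hdecomp : t * limKernel θ x - c * t ^ θ * (max w 0) ^ (θ - 1) =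
        t * (limKernel θ x - (2 * Real.pi) ^ θ * (x ^ (θ - 1) * Real.exp (-(x / 2)) / Real.Gamma θ))
          - c * t ^ θ * w ^ (θ - 1) * (1 - Real.exp (-(x / 2))) := by
      rw [hmax, mul_sub t, hlead]; ring
    -- first piece
    have hT1 : |t * (limKernel θ x - (2 * Real.pi) ^ θ * (x ^ (θ - 1) * Real.exp (-(x / 2)) / Real.Gamma θ))| ≤
        6 * θ * (4 * Real.pi * Real.exp 1 / θ) ^ θ * t ^ (θ + 1) := by
      rw [abs_mul, abs_of_pos ht0]
      have hexp1 : Real.exp (-(x / 2)) ≤ 1 := Real.exp_le_one_iff.mpr (by linarith)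
      have hbase : 2 * Real.pi * Real.exp 1 * x / θ ≤ 4 * Real.pi * Real.exp 1 / θ * t := by
        rw [show 4 * Real.pi * Real.exp 1 / θ * t = 2 * Real.pi * Real.exp 1 * (2 * t) / θ by ring]
        gcongr
      have hbase0 : 0 ≤ 2 * Real.pi * Real.exp 1 * x / θ := by positivity
      have hpow : (2 * Real.pi * Real.exp 1 * x / θ) ^ θ ≤ (4 * Real.pi * Real.exp 1 / θ * t) ^ θ :=
        Real.rpow_le_rpow hbase0 hbase hθ0.le
      calc t * |limKernel θ x - (2 * Real.pi) ^ θ * (x ^ (θ - 1) * Real.exp (-(x / 2)) / Real.Gamma θ)|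
          ≤ t * (6 * θ * (2 * Real.pi * Real.exp 1 * x / θ) ^ θ * Real.exp (-(x / 2))) :=
            mul_le_mul_of_nonneg_left hK ht0.le
        _ ≤ t * (6 * θ * (4 * Real.pi * Real.exp 1 / θ * t) ^ θ * 1) := by gcongr
        _ = 6 * θ * (4 * Real.pi * Real.exp 1 / θ) ^ θ * t ^ (θ + 1) := by
            rw [Real.mul_rpow (by positivity) ht0.le, Real.rpow_add_one ht0.ne' θ]; ring
    -- second piece
    have hT2 : |c * t ^ θ * w ^ (θ - 1) * (1 - Real.exp (-(x / 2)))| ≤ c * 2 ^ (θ - 1) * t ^ (θ + 1) := by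
      have h1e : 0 ≤ 1 - Real.exp (-(x / 2)) := by
        have : Real.exp (-(x / 2)) ≤ 1 := Real.exp_le_one_iff.mpr (by linarith)
        linarith
      have h1e' : 1 - Real.exp (-(x / 2)) ≤ t := by
        have := Real.add_one_le_exp (-(x / 2))
        nlinarith
      have hwk : w ^ (θ - 1) ≤ 2 ^ (θ - 1) := Real.rpow_le_rpow hw0.le hw.le hθ1
      have hw0' : 0 ≤ w ^ (θ - 1) := Real.rpow_nonneg hw0.le _
      rw [abs_of_nonneg (by positivity)]
      calc c * t ^ θ * w ^ (θ - 1) * (1 - Real.exp (-(x / 2)))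
          ≤ c * t ^ θ * 2 ^ (θ - 1) * t := by gcongr
        _ = c * 2 ^ (θ - 1) * t ^ (θ + 1) := by rw [Real.rpow_add_one ht0.ne' θ]; ring
    rw [hdecomp]
    calc |t * (limKernel θ x - (2 * Real.pi) ^ θ * (x ^ (θ - 1) * Real.exp (-(x / 2)) / Real.Gamma θ))
          - c * t ^ θ * w ^ (θ - 1) * (1 - Real.exp (-(x / 2)))|
        ≤ |t * (limKernel θ x - (2 * Real.pi) ^ θ * (x ^ (θ - 1) * Real.exp (-(x / 2)) / Real.Gamma θ))|
          + |c * t ^ θ * w ^ (θ - 1) * (1 - Real.exp (-(x / 2)))| := abs_sub _ _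
      _ ≤ 6 * θ * (4 * Real.pi * Real.exp 1 / θ) ^ θ * t ^ (θ + 1) + c * 2 ^ (θ - 1) * t ^ (θ + 1) :=
          add_le_add hT1 hT2
      _ = (c * 2 ^ (θ - 1) + 6 * θ * (4 * Real.pi * Real.exp 1 / θ) ^ θ) * t ^ (θ + 1) := by ring

/-- RH-FREE · **THE SMALL-WINDOW LAW, every real `θ > 1`** (quantitative form): for `0 < t ≤ 1/12`, ANY bounded realisation
`A` of `𝖪_θ[t]` on `L²(−t,t)` and ANY bounded realisation `B` of the onset operator `A_θ` (kernel `(u+v)₊^{θ−1}` on `L²(−1,1)`):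
`|‖A‖ − c_θ ‖B‖ t^θ| ≤ 2 D_θ t^{θ+1}`.  Nothing here bears on RH. -/
theorem abs_opNorm_winOp_sub_leading_le_real (hθ : 1 < θ) {t : ℝ} (ht0 : 0 < t) (ht : t ≤ 1 / 12)
    {A : Lp ℝ 2 (volume.restrict (Ioo (-t) t)) →L[ℝ] Lp ℝ 2 (volume.restrict (Ioo (-t) t))}
    (hA : ∀ φ, (A φ : ℝ → ℝ) =ᵐ[volume.restrict (Ioo (-t) t)]
      fun x => ∫ y in Ioo (-t) t, limKernel θ (x + y) * φ y)
    {B : Lp ℝ 2 (volume.restrict (Ioo (-1 : ℝ) 1)) →L[ℝ] Lp ℝ 2 (volume.restrict (Ioo (-1 : ℝ) 1))}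
    (hB : ∀ φ, (B φ : ℝ → ℝ) =ᵐ[volume.restrict (Ioo (-1 : ℝ) 1)]
      fun u => ∫ v in Ioo (-1 : ℝ) 1, (max (u + v) 0) ^ (θ - 1) * φ v) :
    |‖A‖ - (2 * Real.pi) ^ θ / Real.Gamma θ * ‖B‖ * t ^ θ| ≤
      2 * ((2 * Real.pi) ^ θ / Real.Gamma θ * 2 ^ (θ - 1) +
          6 * θ * (4 * Real.pi * Real.exp 1 / θ) ^ θ) * t ^ (θ + 1) := by
  have hθ0 : 0 < θ := by linarith
  have hθ1 : 0 ≤ θ - 1 := by linarith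
  have hΓ : 0 < Real.Gamma θ := Real.Gamma_pos_of_pos hθ0
  set c : ℝ := (2 * Real.pi) ^ θ / Real.Gamma θ with hcdef
  set D : ℝ := c * 2 ^ (θ - 1) + 6 * θ * (4 * Real.pi * Real.exp 1 / θ) ^ θ with hDdef
  have hc0 : 0 ≤ c := by positivity
  have hD0 : 0 ≤ D := by positivity
  have htθ : 0 < t ^ θ := Real.rpow_pos_of_pos ht0 θ
  have htθ1 : 0 < t ^ (θ + 1) := Real.rpow_pos_of_pos ht0 _
  set s : ℝ := c * t ^ θ with hsdef
  have hs0 : 0 ≤ s := by positivity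
  have hKc : Continuous (limKernel θ) := Suzuki2020_thm12_continuous hθ
  set Kt : ℝ → ℝ := fun w => t * limKernel θ (t * w) with hKtdef
  have hKt : Continuous Kt := continuous_const.mul (hKc.comp (continuous_const.mul continuous_id))
  obtain ⟨Bt, hBt⟩ := exists_winOp hKt 1
  have hnorm : ‖A‖ = ‖Bt‖ := opNorm_winOp_eq_dilate ht0 hA hBt
  set b : ℝ → ℝ := fun w => (max w 0) ^ (θ - 1) with hbdef
  have hb : Continuous b := (continuous_id.max continuous_const).rpow_const fun _ => Or.inr hθ1
  set E : ℝ → ℝ := fun w => Kt w - s * b w with hEdef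
  have hE : Continuous E := hKt.sub (continuous_const.mul hb)
  have hEop : ∀ φ : Lp ℝ 2 (volume.restrict (Ioo (-1 : ℝ) 1)),
      (((Bt - s • B) φ : Lp ℝ 2 (volume.restrict (Ioo (-1 : ℝ) 1))) : ℝ → ℝ)
        =ᵐ[volume.restrict (Ioo (-1 : ℝ) 1)] fun u => ∫ v in Ioo (-1 : ℝ) 1, E (u + v) * φ v := by
    intro φ
    have hsec1 := ae_memLp_l2Kernel_section (memLp_winKernel hKt 1)
    have hsec2 := ae_memLp_l2Kernel_section (memLp_winKernel hb 1)
    rw [show (Bt - s • B) φ = Bt φ - s • B φ from rfl]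
    filter_upwards [Lp.coeFn_sub (Bt φ) (s • B φ), Lp.coeFn_smul s (B φ), hBt φ, hB φ, hsec1, hsec2]
      with u hsub hsmul h1 h2 hu1 hu2
    have hi1 : Integrable (fun v => Kt (u + v) * φ v) (volume.restrict (Ioo (-1 : ℝ) 1)) :=
      hu1.integrable_mul (Lp.memLp φ)
    have hi2 : Integrable (fun v => s * ((max (u + v) 0) ^ (θ - 1) * φ v)) (volume.restrict (Ioo (-1 : ℝ) 1)) :=
      (hu2.integrable_mul (Lp.memLp φ)).const_mul s
    rw [hsub, Pi.sub_apply, hsmul, Pi.smul_apply, h1, h2, smul_eq_mul, ← integral_const_mul,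
      ← integral_sub hi1 hi2]
    refine integral_congr_ae (Eventually.of_forall fun v => ?_)
    simp only [hEdef, hKtdef, hbdef]
    ring
  have hEbd : ∀ w : ℝ, w < 2 → |E w| ≤ D * t ^ (θ + 1) := fun w hw => by
    have h := abs_dilKernel_sub_leading_le_real hθ ht0 ht hw
    simp only [hEdef, hKtdef, hbdef, hsdef]
    rwa [hDdef, hcdef]
  have hHS : ‖Bt - s • B‖ ≤ 2 * D * t ^ (θ + 1) := by
    refine (opNorm_winOp_le_sqrt (t := 1) hE hEop).trans ?_
    have hin : ∀ u ∈ Ioo (-1 : ℝ) 1, ∫ v in Ioo (-1 : ℝ) 1, E (u + v) ^ 2 ≤ 2 * (D * t ^ (θ + 1)) ^ 2 := by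
      intro u hu
      have hcu : Continuous fun v => E (u + v) ^ 2 := (hE.comp (continuous_const.add continuous_id)).pow 2
      have h1 : ∫ v in Ioo (-1 : ℝ) 1, E (u + v) ^ 2 ≤ ∫ v in Ioo (-1 : ℝ) 1, (D * t ^ (θ + 1)) ^ 2 := by
        refine setIntegral_mono_on (hcu.integrableOn_Icc.mono_set Ioo_subset_Icc_self)
          (by exact integrableOn_const (by simp)) measurableSet_Ioo fun v hv => ?_
        have hlt : u + v < 2 := by linarith [hu.2, hv.2]
        have hab := hEbd (u + v) hlt
        rw [← sq_abs]
        exact pow_le_pow_left₀ (abs_nonneg _) hab 2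
      rw [setIntegral_const, Real.volume_real_Ioo_of_le (by norm_num), show (1 : ℝ) - -1 = 2 by norm_num,
        smul_eq_mul] at h1
      exact h1
    have hout : ∫ u in Ioo (-1 : ℝ) 1, ∫ v in Ioo (-1 : ℝ) 1, E (u + v) ^ 2 ≤ (2 * D * t ^ (θ + 1)) ^ 2 := by
      have h1 : ∫ u in Ioo (-1 : ℝ) 1, ∫ v in Ioo (-1 : ℝ) 1, E (u + v) ^ 2 ≤
          ∫ u in Ioo (-1 : ℝ) 1, 2 * (D * t ^ (θ + 1)) ^ 2 :=
        setIntegral_mono_on (integrable_integral_l2Kernel_sq (memLp_winKernel hE 1))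
          (by exact integrableOn_const (by simp)) measurableSet_Ioo hin
      rw [setIntegral_const, Real.volume_real_Ioo_of_le (by norm_num), show (1 : ℝ) - -1 = 2 by norm_num,
        smul_eq_mul] at h1
      refine h1.trans (le_of_eq ?_)
      ring
    calc Real.sqrt (∫ u in Ioo (-1 : ℝ) 1, ∫ v in Ioo (-1 : ℝ) 1, E (u + v) ^ 2)
        ≤ Real.sqrt ((2 * D * t ^ (θ + 1)) ^ 2) := Real.sqrt_le_sqrt hout
      _ = 2 * D * t ^ (θ + 1) := Real.sqrt_sq (by positivity)
  have htri : |‖Bt‖ - ‖s • B‖| ≤ ‖Bt - s • B‖ := abs_norm_sub_norm_le Bt (s • B)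
  rw [norm_smul, Real.norm_of_nonneg hs0] at htri
  rw [hnorm, show c * ‖B‖ * t ^ θ = s * ‖B‖ by rw [hsdef]; ring]
  exact htri.trans hHS

/-- RH-FREE · **THE SMALL-WINDOW LAW, limit form, every real `θ > 1`**: for any family of bounded realisations `A t` of
`𝖪_θ[t]` and any realisation `B` of `A_θ`, `‖A t‖ / t^θ → c_θ ‖B‖` as `t → 0⁺`. -/
theorem tendsto_opNorm_winOp_div_rpow (hθ : 1 < θ)
    (A : ∀ t : ℝ, Lp ℝ 2 (volume.restrict (Ioo (-t) t)) →L[ℝ] Lp ℝ 2 (volume.restrict (Ioo (-t) t)))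
    (hA : ∀ t φ, (A t φ : ℝ → ℝ) =ᵐ[volume.restrict (Ioo (-t) t)]
      fun x => ∫ y in Ioo (-t) t, limKernel θ (x + y) * φ y)
    {B : Lp ℝ 2 (volume.restrict (Ioo (-1 : ℝ) 1)) →L[ℝ] Lp ℝ 2 (volume.restrict (Ioo (-1 : ℝ) 1))}
    (hB : ∀ φ, (B φ : ℝ → ℝ) =ᵐ[volume.restrict (Ioo (-1 : ℝ) 1)]
      fun u => ∫ v in Ioo (-1 : ℝ) 1, (max (u + v) 0) ^ (θ - 1) * φ v) :
    Tendsto (fun t : ℝ => ‖A t‖ / t ^ θ) (𝓝[>] 0) (𝓝 ((2 * Real.pi) ^ θ / Real.Gamma θ * ‖B‖)) := by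
  set c : ℝ := (2 * Real.pi) ^ θ / Real.Gamma θ with hcdef
  set D : ℝ := c * 2 ^ (θ - 1) + 6 * θ * (4 * Real.pi * Real.exp 1 / θ) ^ θ with hDdef
  have key : ∀ᶠ t in 𝓝[>] (0 : ℝ), ‖‖A t‖ / t ^ θ - c * ‖B‖‖ ≤ 2 * D * t := by
    filter_upwards [Ioo_mem_nhdsGT (show (0 : ℝ) < 1 / 12 by norm_num)] with t ht
    have ht0 : 0 < t := ht.1
    have htk : 0 < t ^ θ := Real.rpow_pos_of_pos ht0 θ
    have h := abs_opNorm_winOp_sub_leading_le_real hθ ht0 ht.2.le (hA t) hB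
    rw [Real.norm_eq_abs,
      show ‖A t‖ / t ^ θ - c * ‖B‖ = (‖A t‖ - c * ‖B‖ * t ^ θ) / t ^ θ by field_simp,
      abs_div, abs_of_pos htk, div_le_iff₀ htk]
    refine h.trans (le_of_eq ?_)
    rw [hDdef, hcdef, Real.rpow_add_one ht0.ne' θ]
    ring
  have hlim : Tendsto (fun t : ℝ => 2 * D * t) (𝓝[>] 0) (𝓝 0) := by
    have h : Tendsto (fun t : ℝ => 2 * D * t) (𝓝 0) (𝓝 (2 * D * 0)) :=
      (continuous_const.mul continuous_id).tendsto 0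
    rw [mul_zero] at h
    exact h.mono_left nhdsWithin_le_nhds
  exact tendsto_sub_nhds_zero_iff.1 (squeeze_zero_norm' key hlim)

/-! ## §2 The onset operator `A_θ` for real `θ > 1`: `2^{2θ}/(θ²(2θ+1)) ≤ ‖A_θ‖² ≤ 2^{2θ}/((2θ−1)2θ)` -/

section Onset

variable {B : Lp ℝ 2 (volume.restrict (Ioo (-1 : ℝ) 1)) →L[ℝ] Lp ℝ 2 (volume.restrict (Ioo (-1 : ℝ) 1))}

/-- `∫_{(−1,1)} (u+v)₊^{θ−1} dv = (u+1)^θ/θ` for `|u| ≤ 1` (real `θ > 1`). -/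
theorem integral_onsetKernel_row_real (hθ : 1 < θ) {u : ℝ} (hu : u ∈ Icc (-1 : ℝ) 1) :
    ∫ v in Ioo (-1 : ℝ) 1, (max (u + v) 0) ^ (θ - 1) = (u + 1) ^ θ / θ := by
  have hθ0 : 0 < θ := by linarith
  have hθ1 : 0 ≤ θ - 1 := by linarith
  have hu1 : u + -1 ≤ 0 := by linarith [hu.2]
  have hu2 : 0 ≤ u + 1 := by linarith [hu.1]
  have hcont : Continuous fun w : ℝ => (max w 0) ^ (θ - 1) :=
    (continuous_id.max continuous_const).rpow_const fun _ => Or.inr hθ1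
  rw [setIntegral_Ioo_eq_intervalIntegral (by norm_num) (fun v => (max (u + v) 0) ^ (θ - 1)),
    intervalIntegral.integral_comp_add_left (fun w => (max w 0) ^ (θ - 1)) u,
    ← intervalIntegral.integral_add_adjacent_intervals (b := 0) (hcont.intervalIntegrable _ _)
      (hcont.intervalIntegrable _ _)]
  have h1 : ∫ w in (u + -1)..0, (max w 0) ^ (θ - 1) = 0 := by
    have h : ∫ w in (u + -1)..0, (max w 0) ^ (θ - 1) = ∫ _ in (u + -1)..(0 : ℝ), (0 : ℝ) := by
      refine intervalIntegral.integral_congr fun w hw => ?_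
      rw [uIcc_of_le hu1] at hw
      simp only [max_eq_right hw.2, Real.zero_rpow (by linarith : θ - 1 ≠ 0)]
    rw [h, intervalIntegral.integral_zero]
  have h2 : ∫ w in (0 : ℝ)..(u + 1), (max w 0) ^ (θ - 1) = (u + 1) ^ θ / θ := by
    rw [← show ∫ w in (0 : ℝ)..(u + 1), w ^ (θ - 1) = (u + 1) ^ θ / θ by
      rw [integral_rpow (Or.inl (by linarith))]
      simp only [sub_add_cancel, Real.zero_rpow hθ0.ne', sub_zero]]
    refine intervalIntegral.integral_congr fun w hw => ?_
    rw [uIcc_of_le hu2] at hw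
    simp only [max_eq_left hw.1]
  rw [h1, h2, zero_add]

/-- RH-FREE · lower bound: `‖A_θ‖² ≥ 2^{2θ}/(θ²(2θ+1))` (test function `𝟙`), real `θ > 1`. -/
theorem sq_opNorm_onsetOp_ge_real (hθ : 1 < θ)
    (hB : ∀ φ, (B φ : ℝ → ℝ) =ᵐ[volume.restrict (Ioo (-1 : ℝ) 1)]
      fun u => ∫ v in Ioo (-1 : ℝ) 1, (max (u + v) 0) ^ (θ - 1) * φ v) :
    (2 : ℝ) ^ (2 * θ) / (θ ^ 2 * (2 * θ + 1)) ≤ ‖B‖ ^ 2 := by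
  have hθ0 : 0 < θ := by linarith
  have hone : MemLp (fun _ : ℝ => (1 : ℝ)) 2 (volume.restrict (Ioo (-1 : ℝ) 1)) := memLp_const 1
  have h := sq_integral_winOp_le (K := fun w => (max w 0) ^ (θ - 1)) hB hone
  have hrow : ∀ u ∈ Ioo (-1 : ℝ) 1, (∫ v in Ioo (-1 : ℝ) 1, (max (u + v) 0) ^ (θ - 1) * (1 : ℝ)) =
      (u + 1) ^ θ / θ := fun u hu => by
    simp only [mul_one]
    exact integral_onsetKernel_row_real hθ (Ioo_subset_Icc_self hu)
  have hL : ∫ u in Ioo (-1 : ℝ) 1, (∫ v in Ioo (-1 : ℝ) 1, (max (u + v) 0) ^ (θ - 1) * (1 : ℝ)) ^ 2 =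
      (2 : ℝ) ^ (2 * θ + 1) / (θ ^ 2 * (2 * θ + 1)) := by
    rw [setIntegral_congr_fun measurableSet_Ioo fun u hu => by rw [hrow u hu],
      setIntegral_Ioo_eq_intervalIntegral (by norm_num)]
    have hc : ∫ u in (-1 : ℝ)..1, ((u + 1) ^ θ / θ) ^ 2 = ∫ u in (-1 : ℝ)..1, (θ ^ 2)⁻¹ * (u + 1) ^ (2 * θ) := by
      refine intervalIntegral.integral_congr fun u hu => ?_
      rw [uIcc_of_le (by norm_num : (-1 : ℝ) ≤ 1)] at hu
      have hu0 : 0 ≤ u + 1 := by linarith [hu.1]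
      rw [div_pow, show ((u + 1) ^ θ) ^ 2 = (u + 1) ^ (2 * θ) by
        rw [← Real.rpow_natCast, ← Real.rpow_mul hu0]; push_cast; ring_nf]
      ring
    rw [hc, intervalIntegral.integral_const_mul,
      intervalIntegral.integral_comp_add_right (fun w => w ^ (2 * θ)) (1 : ℝ),
      integral_rpow (Or.inl (by linarith))]
    rw [show (-1 : ℝ) + 1 = 0 by norm_num, show (1 : ℝ) + 1 = 2 by norm_num,
      Real.zero_rpow (by linarith : 2 * θ + 1 ≠ 0), sub_zero]
    field_simp
  have hR : ∫ u in Ioo (-1 : ℝ) 1, (fun _ : ℝ => (1 : ℝ)) u ^ 2 = 2 := by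
    simp only [one_pow, setIntegral_const, Real.volume_real_Ioo_of_le (by norm_num : (-1 : ℝ) ≤ 1),
      smul_eq_mul, mul_one]
    norm_num
  rw [hL, hR] at h
  have h4 : (2 : ℝ) ^ (2 * θ + 1) = 2 ^ (2 * θ) * 2 := Real.rpow_add_one two_ne_zero _
  rw [h4] at h
  have hpos : 0 < θ ^ 2 * (2 * θ + 1) := by positivity
  rw [div_le_iff₀ hpos]
  have h' := (div_le_iff₀ hpos).mp h
  linarith

/-- RH-FREE · upper bound (Hilbert–Schmidt): `‖A_θ‖² ≤ 2^{2θ}/((2θ−1)2θ)`, real `θ > 1`. -/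
theorem sq_opNorm_onsetOp_le_real (hθ : 1 < θ)
    (hB : ∀ φ, (B φ : ℝ → ℝ) =ᵐ[volume.restrict (Ioo (-1 : ℝ) 1)]
      fun u => ∫ v in Ioo (-1 : ℝ) 1, (max (u + v) 0) ^ (θ - 1) * φ v) :
    ‖B‖ ^ 2 ≤ (2 : ℝ) ^ (2 * θ) / ((2 * θ - 1) * (2 * θ)) := by
  have hθ0 : 0 < θ := by linarith
  have hθ1 : 0 ≤ θ - 1 := by linarith
  have hcont : Continuous fun w : ℝ => (max w 0) ^ (θ - 1) :=
    (continuous_id.max continuous_const).rpow_const fun _ => Or.inr hθ1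
  have h0 : ∀ u : ℝ, u < 0 → (max u 0) ^ (θ - 1) = 0 := fun u hu => by
    rw [max_eq_right hu.le, Real.zero_rpow (by linarith)]
  have h := opNorm_winOp_le_sqrt_weightedSq (t := 1) hcont h0 one_pos hB
  have hI : ∫ u in (0 : ℝ)..(2 * 1), (2 * 1 - u) * ((max u 0) ^ (θ - 1)) ^ 2 =
      (2 : ℝ) ^ (2 * θ) / ((2 * θ - 1) * (2 * θ)) := by
    have hc : ∫ u in (0 : ℝ)..(2 * 1), (2 * 1 - u) * ((max u 0) ^ (θ - 1)) ^ 2 =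
        ∫ u in (0 : ℝ)..2, (2 * u ^ (2 * θ - 2) - u ^ (2 * θ - 1)) := by
      rw [show (2 : ℝ) * 1 = 2 by norm_num]
      refine intervalIntegral.integral_congr fun u hu => ?_
      rw [uIcc_of_le (by norm_num : (0 : ℝ) ≤ 2)] at hu
      simp only [max_eq_left hu.1]
      rw [show (u ^ (θ - 1)) ^ 2 = u ^ (2 * θ - 2) by
          rw [← Real.rpow_natCast, ← Real.rpow_mul hu.1]; push_cast; ring_nf,
        show u ^ (2 * θ - 1) = u ^ (2 * θ - 2) * u ^ (1 : ℝ) by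
          rw [← Real.rpow_add' hu.1 (by linarith : (2 * θ - 2) + 1 ≠ 0)]; ring_nf,
        Real.rpow_one]
      ring
    rw [hc, intervalIntegral.integral_sub (Continuous.intervalIntegrable ?_ _ _)
        (Continuous.intervalIntegrable ?_ _ _), intervalIntegral.integral_const_mul,
      integral_rpow (Or.inl (by linarith)), integral_rpow (Or.inl (by linarith))]
    · rw [Real.zero_rpow (by linarith : 2 * θ - 2 + 1 ≠ 0), Real.zero_rpow (by linarith : 2 * θ - 1 + 1 ≠ 0),
        show (2 : ℝ) * θ - 2 + 1 = 2 * θ - 1 by ring, show (2 : ℝ) * θ - 1 + 1 = 2 * θ by ring,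
        show (2 : ℝ) ^ (2 * θ - 1) = 2 ^ (2 * θ) / 2 by
          rw [Real.rpow_sub_one two_ne_zero]]
      have h2θ : (2 : ℝ) * θ - 1 ≠ 0 := by linarith
      field_simp
      ring
    · exact continuous_const.mul (Real.continuous_rpow_const (by linarith))
    · exact Real.continuous_rpow_const (by linarith)
  have hI0 : 0 ≤ (2 : ℝ) ^ (2 * θ) / ((2 * θ - 1) * (2 * θ)) := by
    have : 0 < 2 * θ - 1 := by linarith
    positivity
  rw [hI] at h
  calc ‖B‖ ^ 2 ≤ (Real.sqrt ((2 : ℝ) ^ (2 * θ) / ((2 * θ - 1) * (2 * θ)))) ^ 2 :=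
        pow_le_pow_left₀ (norm_nonneg _) h 2
    _ = (2 : ℝ) ^ (2 * θ) / ((2 * θ - 1) * (2 * θ)) := Real.sq_sqrt hI0

/-- RH-FREE · positivity of the law's constant: `‖A_θ‖ > 0` for any realisation, real `θ > 1`. -/
theorem opNorm_onsetOp_pos_real (hθ : 1 < θ)
    (hB : ∀ φ, (B φ : ℝ → ℝ) =ᵐ[volume.restrict (Ioo (-1 : ℝ) 1)]
      fun u => ∫ v in Ioo (-1 : ℝ) 1, (max (u + v) 0) ^ (θ - 1) * φ v) : 0 < ‖B‖ := by
  have hθ0 : 0 < θ := by linarith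
  have h := sq_opNorm_onsetOp_ge_real hθ hB
  have hpos : (0 : ℝ) < (2 : ℝ) ^ (2 * θ) / (θ ^ 2 * (2 * θ + 1)) := by positivity
  have hsq : 0 < ‖B‖ ^ 2 := hpos.trans_le h
  rcases (norm_nonneg B).lt_or_eq with h0 | h0
  · exact h0
  · rw [← h0] at hsq; norm_num at hsq

end Onset

end Summit.RiemannHypothesis.RiemannHypothesis.Theorems.SuzukiWindowsDoorSmallWindowLawReal

end
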